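/-
Copyright: lit-balaban Phase-2 proof seat p31 (gen 2).  Statement-level skeleton of a published paper; no proof claims beyond what the
kernel checks below.
-/
import Literature.MathematicalPhysics.QuantumFieldTheory.BalabanImbrieJaffe1984to88.BIJ85CurlQsstar
import Literature.MathematicalPhysics.QuantumFieldTheory.BalabanImbrieJaffe1984to88.BIJ85Eq224Proof

/-!
# `BalabanImbrieJaffe1984to88.BIJ85Eq224ProofPart2` — T. Bałaban, J. Imbrie, A. Jaffe, *Renormalization of the Higgs model: minimizers,
propagators and the stability of mean field theory*, Commun. Math. Phys. **97** (1985) 299–329 [BalabanImbrieJaffe1985]: **(2.24)**,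
part 2 — the k-fold EDGE averages `Q^e_k = (Q^e)^k`, `Q^{e*}_k` on the tori, `Q^e_kQ^{e*}_k = L^{2k}I = η^{−2}I`, and the k-fold identity
`∂Q^{s*}_k = Q^{e*}_k∂` (p. 317, p. 319, p. 323) PROVED

statement-level skeleton of published theorems with citation tags; proofs where landed; nothing here is a claim about the Yang–Mills mass gap

PDF held: `paper:balaban1985-cmp97-bij-higgs-minimizers` (journal page = PDF page + 298).  Pages read as images:
`run/shared/lean/pub/lit-balaban/lit-balaban-r15/pages/1985-cmp97-bij-higgs-minimizers-p007-x2.png` (p. 305), `…-p019-x2.png` (p. 317),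
`…-p021-x2.png` (p. 319); `run/shared/lean/pub/pub-balaban/t4/b2b-balaban-t4-lit2/renders/bij1985/…-p025-x2.png` (p. 323).

CITATION HEADER (lean-in-tree rule).  Part of the lit-balaban TYPED SKELETON (HOME `run/shared/lean/pub/lit-balaban/`), Phase-2 seat
p31 (gen 2), row **C1.Eq2.24** of `HOME/SKELETON.md` (edge part) and the k-fold form of the unnumbered identity of pp. 317/319/323
(inputs of rows C1.Eq5.3.1, C1.Eq6.1.2-6.1.9, C1.Eq6.2.1-6.2.6, C1.Eq7.1.13-7.1.19); continuation of `BIJ85Eq224Proof` (surface part: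
`torusBlockBondsIter`, `Q^s_k = (Q^s)^k`, `Q^s_kQ^{s*}_k = L^kI`) and of `BIJ85CurlQsstar` (one step: `torusEdgeCells`, `∂Q^{s*} = Q^{e*}∂`).
WHAT IS REPRODUCED, and how.  p. 305 [PDF 7], verbatim: *"Especially important are Q^e_k ≡ (Q^e)^k and Q^s_k = (Q^s)^k which satisfy
Q^e_kQ^{e*}_k = L^{2k}I = η^{−2}I, Q^s_kQ^{s*}_k = L^kI = η^{−1}I, (2.24) where η = L^{−k}."*; p. 319 [PDF 21]: *"In addition, note that
Q^eQ^e_k = Q^e_{k+1}."* and *"the identity ∂Q^{s*}_k = Q^{e*}_k∂"*; p. 317 [PDF 19]: *"∂Q^{s*}_kB = Q^{e*}_k∂B"*; p. 323 [PDF 25]: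
*"Q^{e*}_k∂ = ∂Q^{s*}_k"*.  Here, ON THE TORI of `Setup` (fine lattice `T^{(i)}`, coarse lattice `T^{(i+k)}`):
* §1 the k-fold edge-plaquette geometry `torusEdgeCellsIter P i k hd` (an instance of `BIJ85CellAverages.Cells`, m = 2, block size `L^k`;
  `p = ⟨x, μ, ν⟩ ∈ B^e_k(p′)` iff the k-fold blocks of `x + e_μ`, `x + e_ν` are the μ-, ν-neighbours of that of `x` and `p′ = ⟨blockOfIter k x,
  μ, ν⟩`), the nesting **`B^e_{k+1}(p′) = ⨆_{p̄ ∈ B^e(p′)} B^e_k(p̄)`** (`mem_edgeBIter_succ_iff`, from `BIJ85Eq224Proof.blockOfIter_shift`) and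
  the count `|B^e_k(p′)| = L^{k(d−2)}` (`card_edgeBIter`);
* §2 **`Q^e_{k+1} = Q^eQ^e_k`** (p. 319, `QeIter_succ`), its adjoint **`Q^{e*}_{k+1} = Q^{e*}_kQ^{e*}`** (`QestarIter_succ`; the hypothesis
  `hQs` of `BIJ85Eq625Proof`), `Q^e_0 = Q^{e*}_0 = I`, and **(2.24)** `Q^e_kQ^{e*}_k = L^{2k}I = η^{−2}I` OUTRIGHT (`Qe_Qestar_iter`,
  `Qe_Qestar_iter_eta`), `P^e_k` a projection (`Pe_iter_idem`);
* §3 the k-fold identity **`∂Q^{s*}_k = Q^{e*}_k∂`** by induction on `k` from the one-step `BIJ85CurlQsstar.curl_Qsstar` and §2: for every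
  coarse lattice factor `c` (fine factor `L^k·c`), `∂_{L^kc} ∘ Q^{s*}_k = Q^{e*}_k ∘ ∂_c` (`curl_QsstarIter`); in the units of Sects. 4–7
  (fine lattice `T_η`, `∂` with factor `η⁻¹ = L^k`, `η = Params.eta k`; unit coarse lattice, factor 1): `∂_{η⁻¹}(Q^{s*}_kB) = Q^{e*}_k(∂_1B)`
  (`curl_eta_QsstarIter`).
Standing range `i + k ≤ m + K` of `Setup`; `2 ≤ d` (hypothesis `hd`, the carrier's `m ≤ d`).  Unit `lit-balaban-p31`
(literature-prover-lit-balaban-p31-g2-0), 2026-08-21.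
-/

open scoped BigOperators

namespace Literature.MathematicalPhysics.QuantumFieldTheory.BalabanImbrieJaffe1984to88.BIJ85Eq224ProofPart2

open Literature.MathematicalPhysics.QuantumFieldTheory.Balaban1983to89
open BIJ85Sect2SurfaceAverages BIJ85CellAverages LatticeFieldCalculus BIJ85Eq219Proof BIJ85CurlQsstar BIJ85Eq224Proof
  B7SectAStatements

variable {P : Params} {i : ℕ}

/-! ## 0. Torus bookkeeping -/

/-- `y + e_μ ≠ y` on every torus of the series (`1 ≠ 0` in `ZMod (2L^{m+K−j})`). [folklore] -/
private theorem shift_ne_self {j : ℕ} (y : Balaban1983to89.Site P j) (μ : Fin P.d) : y.shift μ ≠ y := by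
  intro h
  have h1 := congrFun h μ
  simp only [Balaban1983to89.Site.shift, Function.update_self] at h1
  exact one_ne_zero (add_eq_left.1 h1)

/-- THE NESTING OF THE EDGE CONDITION: the (k+1)-fold block of `x + e_μ` is the μ-neighbour of that of `x` iff this holds k-fold AND the
k-fold block bond `⟨blockOfIter k x, μ⟩` itself crosses two (one-step) blocks of level `i + k` (standing range).
[cite: BalabanImbrieJaffe1985, (2.24) p.305] -/
theorem blockOfIter_succ_shift_iff {k : ℕ} (hk : i + k + 1 ≤ P.m + P.K) (x : Balaban1983to89.Site P i) (μ : Fin P.d) :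
    blockOfIter (k + 1) (x.shift μ) = (blockOfIter (k + 1) x).shift μ ↔
      blockOfIter k (x.shift μ) = (blockOfIter k x).shift μ ∧
        blockOf ((blockOfIter k x).shift μ) = (blockOf (blockOfIter k x)).shift μ := by
  simp only [blockOfIter_succ]
  constructor
  · intro h
    rcases blockOfIter_shift k (by omega) x μ with h' | h'
    · exact absurd (by rw [← h, h']) (shift_ne_self (blockOf (blockOfIter k x)) μ)
    · exact ⟨h', by rw [← h', h]⟩
  · rintro ⟨h1, h2⟩
    rw [h1, h2]

/-! ## 1. The k-fold edge-plaquette geometry of the tori -/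

/-- BIJ's edge-plaquette geometry (2.21)–(2.23) AT BLOCK SIZE `L^k` (*"the k-fold averaging operators … Q^e_k ≡ (Q^e)^k"*, p. 305)
INSTANTIATED BY THE TORI of the series, as the uniform carrier `BIJ85CellAverages.Cells` with `m = 2`: fine cells `Plaq P i`, coarse cells
`Plaq P (i + k)`, `p = ⟨x, μ, ν⟩ ∈ B^e_k(p′)`, `p′ = ⟨blockOfIter k x, μ, ν⟩`, iff the bonds `⟨x, x + e_μ⟩`, `⟨x, x + e_ν⟩` both leave the k-block
of `x` (the four bonds of `p` touch four distinct k-blocks containing the corners of `p′`); block size `L^k`, `2 ≤ d` (`hd`).  Its `Q`/`Qstar`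
are `Q^e_k`, `Q^{e*}_k` of (2.24). [cite: BalabanImbrieJaffe1985, (2.24) p.305] -/
@[reducible] noncomputable def torusEdgeCellsIter (P : Params) (i k : ℕ) (hd : 2 ≤ P.d) : Cells where
  F := Plaq P i
  C := Plaq P (i + k)
  fF := inferInstance
  fC := inferInstance
  dF := Classical.decEq _
  dC := Classical.decEq _
  cell p := if blockOfIter k (p.src.shift p.μ) = (blockOfIter k p.src).shift p.μ ∧
      blockOfIter k (p.src.shift p.ν) = (blockOfIter k p.src).shift p.ν
    then some ⟨blockOfIter k p.src, p.μ, p.ν, p.hμν⟩ else none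
  L := P.L ^ k
  d := P.d
  m := 2
  one_le_L := Nat.one_le_pow _ _ P.L_pos
  m_le_d := hd

/-- plumbing: the block size of the k-fold edge geometry is `L^k`. [cite: BalabanImbrieJaffe1985, (2.24) p.305] -/
theorem iterE_L (k : ℕ) (hd : 2 ≤ P.d) : (torusEdgeCellsIter P i k hd).L = P.L ^ k := rfl

/-- plumbing: the block size of the one-step edge geometry is `L`. [cite: BalabanImbrieJaffe1985, (2.21) p.305] -/
theorem oneE_L (j : ℕ) (hd : 2 ≤ P.d) : (torusEdgeCells P j hd).L = P.L := rfl

/-- kernel: membership in the k-fold edge set `B^e_k(p′)` on the tori. [cite: BalabanImbrieJaffe1985, (2.24) p.305] -/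
theorem mem_edgeBIter_iff (k : ℕ) (hd : 2 ≤ P.d) (p' : Plaq P (i + k)) (p : Plaq P i) :
    p ∈ (torusEdgeCellsIter P i k hd).B p' ↔
      (blockOfIter k (p.src.shift p.μ) = (blockOfIter k p.src).shift p.μ ∧
        blockOfIter k (p.src.shift p.ν) = (blockOfIter k p.src).shift p.ν) ∧
      (⟨blockOfIter k p.src, p.μ, p.ν, p.hμν⟩ : Plaq P (i + k)) = p' := by
  rw [(torusEdgeCellsIter P i k hd).mem_B]
  show (if blockOfIter k (p.src.shift p.μ) = (blockOfIter k p.src).shift p.μ ∧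
      blockOfIter k (p.src.shift p.ν) = (blockOfIter k p.src).shift p.ν
    then some (⟨blockOfIter k p.src, p.μ, p.ν, p.hμν⟩ : Plaq P (i + k)) else none) = some p' ↔ _
  constructor
  · intro h
    split_ifs at h with hc
    exact ⟨hc, Option.some_injective _ h⟩
  · rintro ⟨hc, h⟩
    rw [if_pos hc, h]

/-- kernel: the one-step membership (`BIJ85CurlQsstar.torusEdgeCells`) in the same form. [cite: BalabanImbrieJaffe1985, (2.21) p.305] -/
theorem mem_edgeB_iff' {j : ℕ} (hd : 2 ≤ P.d) (p' : Plaq P (j + 1)) (p : Plaq P j) :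
    p ∈ (torusEdgeCells P j hd).B p' ↔
      (blockOf (p.src.shift p.μ) = (blockOf p.src).shift p.μ ∧ blockOf (p.src.shift p.ν) = (blockOf p.src).shift p.ν) ∧
      (⟨blockOf p.src, p.μ, p.ν, p.hμν⟩ : Plaq P (j + 1)) = p' := by
  rw [(torusEdgeCells P j hd).mem_B]
  show (if blockOf (p.src.shift p.μ) = (blockOf p.src).shift p.μ ∧ blockOf (p.src.shift p.ν) = (blockOf p.src).shift p.ν
    then some (⟨blockOf p.src, p.μ, p.ν, p.hμν⟩ : Plaq P (j + 1)) else none) = some p' ↔ _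
  constructor
  · intro h
    split_ifs at h with hc
    exact ⟨hc, Option.some_injective _ h⟩
  · rintro ⟨hc, h⟩
    rw [if_pos hc, h]

/-- kernel: at k = 0 (block size 1) the edge set of a plaquette is the plaquette itself. [cite: BalabanImbrieJaffe1985, (2.24) p.305] -/
theorem edgeBIter_zero (hd : 2 ≤ P.d) (p' : Plaq P i) : (torusEdgeCellsIter P i 0 hd).B p' = {p'} := by
  ext p
  rw [mem_edgeBIter_iff, Finset.mem_singleton]
  obtain ⟨x, μ, ν, hμν⟩ := p
  simp only [blockOfIter_zero, true_and]

/-- kernel: the k-fold block plaquette `⟨blockOfIter k x, μ, ν⟩` is the ONLY coarse plaquette whose edge set contains `⟨x, μ, ν⟩`.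
[cite: BalabanImbrieJaffe1985, (2.24) p.305] -/
theorem barPlaq_eq_of_mem {k : ℕ} (hd : 2 ≤ P.d) {pp : Plaq P (i + k)} {p : Plaq P i}
    (h : p ∈ (torusEdgeCellsIter P i k hd).B pp) : pp = ⟨blockOfIter k p.src, p.μ, p.ν, p.hμν⟩ :=
  (((mem_edgeBIter_iff k hd pp p).mp h).2).symm

/-- THE NESTING OF THE EDGE SETS: `p` is a (k+1)-edge plaquette of `p′` iff its k-fold block plaquette `p̄` is a (one-step) edge plaquette of
`p′` at level `i + k` and `p` is a k-edge plaquette of `p̄` — `B^e_{k+1}(p′) = ⋃_{p̄ ∈ B^e(p′)} B^e_k(p̄)` (standing range).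
[cite: BalabanImbrieJaffe1985, (2.24) p.305] -/
theorem mem_edgeBIter_succ_iff {k : ℕ} (hk : i + k + 1 ≤ P.m + P.K) (hd : 2 ≤ P.d) (p' : Plaq P (i + k + 1)) (p : Plaq P i) :
    p ∈ (torusEdgeCellsIter P i (k + 1) hd).B p' ↔
      (⟨blockOfIter k p.src, p.μ, p.ν, p.hμν⟩ : Plaq P (i + k)) ∈ (torusEdgeCells P (i + k) hd).B p' ∧
        p ∈ (torusEdgeCellsIter P i k hd).B ⟨blockOfIter k p.src, p.μ, p.ν, p.hμν⟩ := by
  rw [mem_edgeBIter_iff, mem_edgeBIter_iff, mem_edgeB_iff', blockOfIter_succ_shift_iff hk, blockOfIter_succ_shift_iff hk]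
  simp only [blockOfIter_succ, and_true]
  tauto

/-- The printed count behind (2.24): `|B^e_k(p′)| = (L^k)^{d−2}` on the tori (induction on `k` through the nesting and the one-step count
`BIJ85CurlQsstar.card_edgeB`; standing range). [cite: BalabanImbrieJaffe1985, (2.24) p.305] -/
theorem card_edgeBIter (hd : 2 ≤ P.d) : ∀ (k : ℕ), i + k ≤ P.m + P.K → ∀ p' : Plaq P (i + k),
    ((torusEdgeCellsIter P i k hd).B p').card = (P.L ^ k) ^ (P.d - 2)
  | 0, _, p' => by rw [edgeBIter_zero, Finset.card_singleton, pow_zero, one_pow]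
  | k + 1, hk, p' => by
    classical
    have hunion : (torusEdgeCellsIter P i (k + 1) hd).B p' =
        ((torusEdgeCells P (i + k) hd).B p').biUnion fun pp => (torusEdgeCellsIter P i k hd).B pp := by
      ext p
      rw [Finset.mem_biUnion, mem_edgeBIter_succ_iff hk]
      constructor
      · rintro ⟨h1, h2⟩
        exact ⟨_, h1, h2⟩
      · rintro ⟨pp, h1, h2⟩
        obtain rfl := barPlaq_eq_of_mem hd h2
        exact ⟨h1, h2⟩
    rw [hunion, Finset.card_biUnion (fun pp _ pp' _ hne => Finset.disjoint_left.mpr fun p hp hp' =>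
      hne ((torusEdgeCellsIter P i k hd).B_unique hp hp'))]
    rw [Finset.sum_congr rfl fun pp _ => card_edgeBIter hd k (by omega) pp, Finset.sum_const,
      card_edgeB (by omega : i + k + 1 ≤ P.m + P.K) hd p', smul_eq_mul, ← mul_pow, ← pow_succ']

/-! ## 2. `Q^e_{k+1} = Q^eQ^e_k` (p. 319), `Q^{e*}_{k+1} = Q^{e*}_kQ^{e*}`, and (2.24) -/

/-- kernel: `Q^{e*}_0 = I` (block size 1). [cite: BalabanImbrieJaffe1985, (2.24) p.305] -/
theorem QestarIter_zero (hd : 2 ≤ P.d) (g : Plaq P i → ℝ) : (torusEdgeCellsIter P i 0 hd).Qstar g = g := by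
  funext p
  have hp : p ∈ (torusEdgeCellsIter P i 0 hd).B p := by rw [edgeBIter_zero]; exact Finset.mem_singleton_self p
  rw [(torusEdgeCellsIter P i 0 hd).Qstar_of_mem g hp, iterE_L, pow_zero, Nat.cast_one, one_pow, one_mul]

/-- kernel: `Q^e_0 = I` (block size 1). [cite: BalabanImbrieJaffe1985, (2.24) p.305] -/
theorem QeIter_zero (hd : 2 ≤ P.d) (f : Plaq P i → ℝ) : (torusEdgeCellsIter P i 0 hd).Q f = f := by
  funext p'
  unfold Cells.Q
  rw [edgeBIter_zero, Finset.sum_singleton, iterE_L, pow_zero, Nat.cast_one, one_pow, inv_one, one_mul]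

/-- **`Q^{e*}_{k+1} = Q^{e*}_kQ^{e*}`** — the adjoint of the printed *"Q^eQ^e_k = Q^e_{k+1}"* (p. 319; the hypothesis `hQs` "Q^{e*}_kQ^{e*} =
Q^{e*}_{k+1}" of `BIJ85Eq625Proof`): the pull-back (2.22) at block size `L^{k+1}` is the k-fold pull-back of the one-step pull-back at level
`i + k` (values `L^{2(k+1)}g(p′)` on the (k+1)-edge plaquettes of `p′`, `0` elsewhere; standing range). [cite: BalabanImbrieJaffe1985, (6.1.3) p.319] -/
theorem QestarIter_succ {k : ℕ} (hk : i + k + 1 ≤ P.m + P.K) (hd : 2 ≤ P.d) (g : Plaq P (i + k + 1) → ℝ) :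
    (torusEdgeCellsIter P i (k + 1) hd).Qstar g =
      (torusEdgeCellsIter P i k hd).Qstar ((torusEdgeCells P (i + k) hd).Qstar g) := by
  funext p
  by_cases h : ∃ p', p ∈ (torusEdgeCellsIter P i (k + 1) hd).B p'
  · obtain ⟨p', hp⟩ := h
    have h' := (mem_edgeBIter_succ_iff hk hd p' p).mp hp
    rw [(torusEdgeCellsIter P i (k + 1) hd).Qstar_of_mem g hp, (torusEdgeCellsIter P i k hd).Qstar_of_mem _ h'.2,
      (torusEdgeCells P (i + k) hd).Qstar_of_mem g h'.1, iterE_L, iterE_L, oneE_L]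
    push_cast
    ring
  · push Not at h
    rw [(torusEdgeCellsIter P i (k + 1) hd).Qstar_of_not_mem g h]
    by_cases h2 : ∃ pp, p ∈ (torusEdgeCellsIter P i k hd).B pp
    · obtain ⟨pp, hpp⟩ := h2
      rw [(torusEdgeCellsIter P i k hd).Qstar_of_mem _ hpp, (torusEdgeCells P (i + k) hd).Qstar_of_not_mem g, mul_zero]
      intro p' hp'
      apply h p'
      obtain rfl := barPlaq_eq_of_mem hd hpp
      exact (mem_edgeBIter_succ_iff hk hd p' p).mpr ⟨hp', hpp⟩
    · push Not at h2
      rw [(torusEdgeCellsIter P i k hd).Qstar_of_not_mem _ h2]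

/-- **`Q^e_{k+1} = Q^eQ^e_k`** — p. 319 [PDF 21], verbatim: *"In addition, note that Q^eQ^e_k = Q^e_{k+1}."* (the printed *"Q^e_k ≡ (Q^e)^k"*
of (2.24)): the edge average (2.21) at block size `L^{k+1}` is the one-step edge average at level `i + k` of the edge average at block size
`L^k` (the (k+1)-edge set is the disjoint union of the k-edge sets of the plaquettes of the 1-edge set, `L^{−k(d−2)}·L^{−(d−2)} =
L^{−(k+1)(d−2)}`; standing range). [cite: BalabanImbrieJaffe1985, (6.1.3) p.319] -/
theorem QeIter_succ {k : ℕ} (hk : i + k + 1 ≤ P.m + P.K) (hd : 2 ≤ P.d) (f : Plaq P i → ℝ) :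
    (torusEdgeCellsIter P i (k + 1) hd).Q f = (torusEdgeCells P (i + k) hd).Q ((torusEdgeCellsIter P i k hd).Q f) := by
  classical
  funext p'
  have hunion : (torusEdgeCellsIter P i (k + 1) hd).B p' =
      ((torusEdgeCells P (i + k) hd).B p').biUnion fun pp => (torusEdgeCellsIter P i k hd).B pp := by
    ext p
    rw [Finset.mem_biUnion, mem_edgeBIter_succ_iff hk]
    constructor
    · rintro ⟨h1, h2⟩
      exact ⟨_, h1, h2⟩
    · rintro ⟨pp, h1, h2⟩
      obtain rfl := barPlaq_eq_of_mem hd h2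
      exact ⟨h1, h2⟩
  unfold Cells.Q
  rw [hunion, Finset.sum_biUnion (fun pp _ pp' _ hne => Finset.disjoint_left.mpr fun p hp hp' =>
    hne ((torusEdgeCellsIter P i k hd).B_unique hp hp')), iterE_L, iterE_L, oneE_L, Finset.mul_sum, Finset.mul_sum]
  refine Finset.sum_congr rfl fun pp _ => ?_
  push_cast
  rw [← mul_assoc]
  congr 1
  rw [pow_succ', mul_pow, mul_inv]

/-- **(2.24)** p. 305 [PDF 7], edge part, verbatim: *"Q^e_kQ^{e*}_k = L^{2k}I"* — PROVED OUTRIGHT on the tori of the series for the k-fold edge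
geometry `torusEdgeCellsIter` (the count `|B^e_k(p′)| = L^{k(d−2)}` discharged by `card_edgeBIter`; standing range, `2 ≤ d`).
[cite: BalabanImbrieJaffe1985, (2.24) p.305] -/
theorem Qe_Qestar_iter {k : ℕ} (hk : i + k ≤ P.m + P.K) (hd : 2 ≤ P.d) (g : Plaq P (i + k) → ℝ) (p' : Plaq P (i + k)) :
    (torusEdgeCellsIter P i k hd).Q ((torusEdgeCellsIter P i k hd).Qstar g) p' = (P.L : ℝ) ^ (2 * k) * g p' := by
  rw [(torusEdgeCellsIter P i k hd).Q_Qstar (card_edgeBIter hd k hk) g p', iterE_L]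
  push_cast
  ring

/-- **(2.24)** p. 305 [PDF 7], edge part in the η-form, verbatim: *"Q^e_kQ^{e*}_k = L^{2k}I = η^{−2}I, … where η = L^{−k}"* — with
`η = Params.eta k` of `Setup` (standing range, `2 ≤ d`). [cite: BalabanImbrieJaffe1985, (2.24) p.305] -/
theorem Qe_Qestar_iter_eta {k : ℕ} (hk : i + k ≤ P.m + P.K) (hd : 2 ≤ P.d) (g : Plaq P (i + k) → ℝ) (p' : Plaq P (i + k)) :
    (torusEdgeCellsIter P i k hd).Q ((torusEdgeCellsIter P i k hd).Qstar g) p' = ((P.eta k)⁻¹) ^ 2 * g p' := by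
  rw [Qe_Qestar_iter hk hd, Params.eta]
  simp only [inv_pow, inv_inv]
  ring

/-- **(2.24)** with (2.23): `Q^{e*}_kQ^e_k = L^{2k}P^e_k` where `P^e_k` (the average over the k-edge set containing the plaquette, zero
elsewhere) IS a projection on the tori — idempotent outright (`Cells.P_idem` with the count `card_edgeBIter`; symmetric by
`Cells.inner_P_symm`), the identity itself being `Cells.Qstar_Q` (standing range, `2 ≤ d`). [cite: BalabanImbrieJaffe1985, (2.24) p.305] -/
theorem Pe_iter_idem {k : ℕ} (hk : i + k ≤ P.m + P.K) (hd : 2 ≤ P.d) (f : Plaq P i → ℝ) (p : Plaq P i) :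
    (torusEdgeCellsIter P i k hd).P ((torusEdgeCellsIter P i k hd).P f) p = (torusEdgeCellsIter P i k hd).P f p :=
  (torusEdgeCellsIter P i k hd).P_idem (card_edgeBIter hd k hk) f p

/-! ## 3. The k-fold identity `∂Q^{s*}_k = Q^{e*}_k∂` (p. 317, p. 319, p. 323) -/

/-- **`∂Q^{s*}_k = Q^{e*}_k∂`** — p. 317 [PDF 19], verbatim: *"Use the facts Q_kQ^{s*}_k = I and ∂Q^{s*}_kB = Q^{e*}_k∂B"*; p. 319 [PDF 21]:
*"and the identity ∂Q^{s*}_k = Q^{e*}_k∂"*; p. 323 [PDF 25]: *"Furthermore Q^{e*}_k∂ = ∂Q^{s*}_k"* — PROVED for every `k` on the tori of the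
series as an identity of maps (bond fields on `T^{(i+k)}` → plaquette fields on `T^{(i)}`): for every coarse lattice factor `c` (fine factor
`L^k·c`), `∂_{L^kc} ∘ Q^{s*}_k = Q^{e*}_k ∘ ∂_c`, with `Q^{s*}_k` = `BlockBonds.Qsstar` of `BIJ85Eq224Proof.torusBlockBondsIter` and `Q^{e*}_k` =
`Cells.Qstar` of `torusEdgeCellsIter`; induction on `k`: `Q^{s*}_{k+1} = Q^{s*}_kQ^{s*}`, the one-step `BIJ85CurlQsstar.curl_Qsstar` at level
`i + k`, `Q^{e*}_kQ^{e*} = Q^{e*}_{k+1}` (standing range, `2 ≤ d`). [cite: BalabanImbrieJaffe1985, (5.3.1) p.317] -/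
theorem curl_QsstarIter (hd : 2 ≤ P.d) : ∀ (k : ℕ), i + k ≤ P.m + P.K → ∀ (c : ℝ) (B : PBond P (i + k) → ℝ),
    curl ((P.L : ℝ) ^ k * c) ((torusBlockBondsIter P i k).Qsstar B) = (torusEdgeCellsIter P i k hd).Qstar (curl c B)
  | 0, _, c, B => by rw [QsstarIter_zero, QestarIter_zero, pow_zero, one_mul]
  | k + 1, hk, c, B => by
    rw [QsstarIter_succ hk, QestarIter_succ hk hd, pow_succ, mul_assoc,
      curl_QsstarIter hd k (by omega) ((P.L : ℝ) * c) ((torusBlockBonds P (i + k)).Qsstar B),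
      curl_Qsstar (by omega : i + k + 1 ≤ P.m + P.K) hd c B]

/-- **`Q^{e*}_k∂ = ∂Q^{s*}_k`** in the units of Sects. 4–7 (fine lattice `T_η`, `η = L^{−k} = Params.eta k`, `∂` with factor `η⁻¹`; unit
coarse lattice, `∂` with factor `1`): `∂_{η⁻¹}(Q^{s*}_kB) = Q^{e*}_k(∂B)` on the tori — the form entering (5.3.1) p. 317, (6.1.5) p. 319 and
(7.1.18) p. 323 (standing range, `2 ≤ d`). [cite: BalabanImbrieJaffe1985, (7.1.18) p.323] -/
theorem curl_eta_QsstarIter (hd : 2 ≤ P.d) {k : ℕ} (hk : i + k ≤ P.m + P.K) (B : PBond P (i + k) → ℝ) :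
    curl (P.eta k)⁻¹ ((torusBlockBondsIter P i k).Qsstar B) = (torusEdgeCellsIter P i k hd).Qstar (curl 1 B) := by
  rw [← curl_QsstarIter hd k hk 1 B, Params.eta, inv_pow, inv_inv, mul_one]

end Literature.MathematicalPhysics.QuantumFieldTheory.BalabanImbrieJaffe1984to88.BIJ85Eq224ProofPart2
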